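import Mathlib
import HarnessLib
import Summits.Ventures.LatticeQCDFlow.Exactness.SphereLOCarrePairConditionalMean
import Summits.Ventures.LatticeQCDFlow.Exactness.SphereLatticeFourthMoment

/-!
# The conditional variance of the static block term given a coupled pair, in closed form: `Var(E[V_I | ω_k, ω_l]) = 32κ⁴β_{kl}⁴/((d−1)d²(d+2))`

HONEST FRAMING: exact (Metropolis-corrected) sampling algorithms for lattice gauge theory;
figures of merit are autocorrelation/cost numbers at stated couplings and volumes; no
continuum-physics claim.

Venture `LatticeQCDFlow` (cell pub-lqcd), topic `Exactness`; FANOUT row 7 (`s0-cpn-null`).  NEW WORK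
of the cell over this lineage's `Exactness/SphereLOCarrePairConditionalMean.lean`
(`Var(A_{Λ∖{k,l}} V_I) = 4(2κ²/(d−1))²·Var(⟪ω_k, U_{kl}ω_l⟫²)` for a coupled, triangle-free pair of a
lattice with scaled-isometric links) and `Exactness/SphereLatticeFourthMoment.lean` (the fourth
spherical moments: `Var(⟪x_k, U x_l⟫²) = 2(d−1)β⁴/(d²(d+2))` for `‖Uv‖ = β‖v‖`), with
`Exactness/SphereLatticeMoments.lean` (`∫⟪x_k, U x_l⟫² = ‖U‖²_HS/d²`); nothing is cited as a fact.
Printed counterpart, NAMED ONLY: Engel–Schaefer, Comput. Phys. Commun. 182 (2011) 2107, §2 (the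
CP(N−1) action in real form, `d = 2N`, unitary links).  The point: the two-site conditional variances
through which `Exactness/SphereLOFlowEntropyFloorPairs` bounds the block terms of the reverse relative
entropy of the exact leading-order flow sampler are, for every coupled pair `{k,l}` without a common
neighbour inside the block, the EXPLICIT POSITIVE CONSTANT `32κ⁴β_{kl}⁴/((d−1)d²(d+2))` — flow-free,
volume-free, and independent of every other link.

## Content

* `integral_sq_inner_clm_apply_of_scaled_isometric` — `∫⟪x_k, U x_l⟫² dπ̄ = β²/d` (`k ≠ l`,
  `‖Uv‖ = β‖v‖`); `integral_sq_sq_inner_sub_mean_of_scaled_isometric` — the centred form of the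
  fourth-moment identity, `∫(⟪x_k, U x_l⟫² − ∫⟪x_k, U x_l⟫²)² dπ̄ = 2(d−1)β⁴/(d²(d+2))`.
* **`variance_coordAvg_pair_loCarreBlock_eq_of_isometric`** —
  `Var_π̄(A_{Λ∖{k,l}} V_I) = 32κ⁴β_{kl}⁴/((d−1)d²(d+2))` (no self-coupling, adjoint pairs,
  scaled-isometric links, `k ≠ l` without a common neighbour, `k, l ∈ I`);
  `variance_coordAvg_pair_loCarreBlock_pos` — it is `> 0` as soon as `κ ≠ 0` and `β_{kl} ≠ 0`.

NOT CLAIMED: pairs with a common neighbour; non-isometric links; anything about the flow, the entropy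
floor itself (see the sequel `Exactness/SphereLOFlowEntropyFloorExplicit.lean`), or numbers.
-/

noncomputable section

namespace Summit.Ventures.LatticeQCDFlow.Exactness

open Function Set Metric MeasureTheory NormedSpace InnerProductSpace
open scoped RealInnerProductSpace

variable {Λ : Type*} {E : Type*} [NormedAddCommGroup E] [InnerProductSpace ℝ E]
  [FiniteDimensional ℝ E] [MeasurableSpace E] [BorelSpace E] [Fintype Λ] [DecidableEq Λ] [Nontrivial E]

/-- **`∫ ⟪x_k, U x_l⟫² dπ̄ = β²/d`** for `k ≠ l` and a scaled isometry `‖Uv‖ = β‖v‖` (`‖U‖²_HS = dβ²`). -/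
theorem integral_sq_inner_clm_apply_of_scaled_isometric (U : E →L[ℝ] E) {β : ℝ}
    (hU : ∀ v, ‖U v‖ = β * ‖v‖) {k l : Λ} (hkl : k ≠ l) :
    ∫ ω, ⟪((ω : Λ → sphere (0 : E) 1) k : E), U ((ω l : E))⟫ ^ 2
        ∂Measure.pi (fun _ : Λ => uniformSphere (volume : Measure E)) =
      β ^ 2 / (Module.finrank ℝ E : ℝ) := by
  have hd : (0 : ℝ) < (Module.finrank ℝ E : ℝ) := by exact_mod_cast Module.finrank_pos
  rw [integral_sq_inner_clm_apply U hkl, sum_norm_sq_apply_of_scaled_isometric U hU]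
  field_simp

/-- The centred fourth-moment identity: `∫ (⟪x_k, U x_l⟫² − ∫⟪x_k, U x_l⟫² dπ̄)² dπ̄ = 2(d−1)β⁴/(d²(d+2))`
(`k ≠ l`, `‖Uv‖ = β‖v‖`). -/
theorem integral_sq_sq_inner_sub_mean_of_scaled_isometric (U : E →L[ℝ] E) {β : ℝ}
    (hU : ∀ v, ‖U v‖ = β * ‖v‖) {k l : Λ} (hkl : k ≠ l) :
    ∫ ω, (⟪((ω : Λ → sphere (0 : E) 1) k : E), U ((ω l : E))⟫ ^ 2 -
        ∫ ω', ⟪((ω' : Λ → sphere (0 : E) 1) k : E), U ((ω' l : E))⟫ ^ 2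
          ∂Measure.pi (fun _ : Λ => uniformSphere (volume : Measure E))) ^ 2
        ∂Measure.pi (fun _ : Λ => uniformSphere (volume : Measure E)) =
      2 * ((Module.finrank ℝ E : ℝ) - 1) * β ^ 4 /
        ((Module.finrank ℝ E : ℝ) ^ 2 * ((Module.finrank ℝ E : ℝ) + 2)) := by
  rw [integral_sq_inner_clm_apply_of_scaled_isometric U hU hkl]
  exact variance_sq_inner_clm_apply_of_isometric U hU hkl

variable {U : Λ → Λ → (E →L[ℝ] E)} {β : Λ → Λ → ℝ} {k l : Λ}

/-- **THE CONDITIONAL VARIANCE OF THE STATIC BLOCK TERM GIVEN A COUPLED PAIR, IN CLOSED FORM.**  No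
self-coupling, adjoint pairs, scaled-isometric links (`‖U_{nm}v‖ = β_{nm}‖v‖`), `k ≠ l` without a common
neighbour (`U_{nk} = 0` or `U_{nl} = 0` for every `n`), `k, l ∈ I`, `d = dim E ≥ 2`:
`Var_π̄(A_{Λ∖{k,l}} V_I) = Var(E[V_I | ω_k, ω_l]) = 32κ⁴β_{kl}⁴/((d−1)·d²·(d+2))`. -/
theorem variance_coordAvg_pair_loCarreBlock_eq_of_isometric (h2 : 2 ≤ Module.finrank ℝ E)
    (hU0 : ∀ n, U n n = 0) (hUadj : ∀ m n (v w : E), ⟪U m n v, w⟫ = ⟪v, U n m w⟫)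
    (hβ : ∀ n m (v : E), ‖U n m v‖ = β n m * ‖v‖) (hkl : k ≠ l) (htri : ∀ n, U n k = 0 ∨ U n l = 0)
    {I : Finset Λ} (hkI : k ∈ I) (hlI : l ∈ I) (κ : ℝ) :
    ∫ ω, (coordAvg (uniformSphere (volume : Measure E)) (Finset.univ \ {k, l}) (fun ω => ∑ n ∈ I,
          2 * κ ^ 2 / ((Module.finrank ℝ E : ℝ) - 1) *
            ‖tangentKick (localField U n (fun i => ((ω i : sphere (0 : E) 1) : E))) (ω n : E)‖ ^ 2) ω -
          ∫ ω', (∑ n ∈ I, 2 * κ ^ 2 / ((Module.finrank ℝ E : ℝ) - 1) *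
            ‖tangentKick (localField U n (fun i => ((ω' i : sphere (0 : E) 1) : E))) (ω' n : E)‖ ^ 2)
            ∂Measure.pi (fun _ : Λ => uniformSphere (volume : Measure E))) ^ 2
          ∂Measure.pi (fun _ : Λ => uniformSphere (volume : Measure E)) =
      32 * κ ^ 4 * β k l ^ 4 /
        (((Module.finrank ℝ E : ℝ) - 1) * (Module.finrank ℝ E : ℝ) ^ 2 * ((Module.finrank ℝ E : ℝ) + 2)) := by
  have hd : (0 : ℝ) < (Module.finrank ℝ E : ℝ) := by exact_mod_cast Module.finrank_pos
  have hd1 : (0 : ℝ) < (Module.finrank ℝ E : ℝ) - 1 := by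
    have : (2 : ℝ) ≤ Module.finrank ℝ E := by exact_mod_cast h2
    linarith
  rw [variance_coordAvg_pair_loCarreBlock_eq h2 hU0 hUadj hβ hkl htri hkI hlI κ,
    integral_sq_sq_inner_sub_mean_of_scaled_isometric (U k l) (hβ k l) hkl]
  field_simp
  ring

/-- **It is strictly positive** as soon as `κ ≠ 0` and the pair is actually coupled (`β_{kl} ≠ 0`). -/
theorem variance_coordAvg_pair_loCarreBlock_pos (h2 : 2 ≤ Module.finrank ℝ E)
    (hU0 : ∀ n, U n n = 0) (hUadj : ∀ m n (v w : E), ⟪U m n v, w⟫ = ⟪v, U n m w⟫)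
    (hβ : ∀ n m (v : E), ‖U n m v‖ = β n m * ‖v‖) (hkl : k ≠ l) (htri : ∀ n, U n k = 0 ∨ U n l = 0)
    {I : Finset Λ} (hkI : k ∈ I) (hlI : l ∈ I) {κ : ℝ} (hκ : κ ≠ 0) (hβkl : β k l ≠ 0) :
    0 < ∫ ω, (coordAvg (uniformSphere (volume : Measure E)) (Finset.univ \ {k, l}) (fun ω => ∑ n ∈ I,
          2 * κ ^ 2 / ((Module.finrank ℝ E : ℝ) - 1) *
            ‖tangentKick (localField U n (fun i => ((ω i : sphere (0 : E) 1) : E))) (ω n : E)‖ ^ 2) ω -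
          ∫ ω', (∑ n ∈ I, 2 * κ ^ 2 / ((Module.finrank ℝ E : ℝ) - 1) *
            ‖tangentKick (localField U n (fun i => ((ω' i : sphere (0 : E) 1) : E))) (ω' n : E)‖ ^ 2)
            ∂Measure.pi (fun _ : Λ => uniformSphere (volume : Measure E))) ^ 2
          ∂Measure.pi (fun _ : Λ => uniformSphere (volume : Measure E)) := by
  have hd : (0 : ℝ) < (Module.finrank ℝ E : ℝ) := by exact_mod_cast Module.finrank_pos
  have hd1 : (0 : ℝ) < (Module.finrank ℝ E : ℝ) - 1 := by
    have : (2 : ℝ) ≤ Module.finrank ℝ E := by exact_mod_cast h2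
    linarith
  rw [variance_coordAvg_pair_loCarreBlock_eq_of_isometric h2 hU0 hUadj hβ hkl htri hkI hlI κ]
  have hκ4 : 0 < κ ^ 4 := by positivity
  have hβ4 : 0 < β k l ^ 4 := by positivity
  positivity

end Summit.Ventures.LatticeQCDFlow.Exactness

end
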